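import Literature.NumberTheory.Weil1965.SplitPlaceCoefficientVanishing
import HarnessLib

/-!
# H413 · E-2 · SW2 identity road (W): the I-CLOSE CORE at a split place (Weil 1965, n° 51, proof of Thm 4, (39)–(40))

Cell `hodgecm-mathlib`, crux H413 (stmt-HodgeConjecture-24833), child line `Cruxes/H413/Lines/F0_E2SiegelWeilWeilRange.lean`,
stub `stub_SW2_siegelWeil`, conjunct (iii); pen sheet `F0/P4/F0P2a-p08/SW2-ICLOSE-ASSEMBLY.v0` §2 steps (1)–(4) (F0P4-plan (g4) row
2026-08-31T03:22Z).  CLOSER-MODULO-LETTERS, Literature-only imports (no `Cruxes/**/Lines/*`).  HC_CM is proved only modulo the 7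
printed citations until rung 0 closes; nothing here is about Hodge classes.

THE STEP.  At the auxiliary finite place `v` of `F` split in `E`, after transport by `β_v × id` ((BRIDGE-v), not here), the theta-side
and Eisenstein-side fibre measures `μ̂_b`, `μ_b` become measures `μ̂′`, `μ′` on `X_v × Y`, `X_v = F_vᴺ × F_vᴺ`, with `GL_N(F_v)`-invariant
rectangle masses, finite on `compact × B`, carried by `S_{b′} × Y`.  By (J-v) (★ `exists_measure_prod_splitLocus_eq_mul_fibreMeasure`)
`μ̂′(A × B) = ĉ_B μ_{b′,v}(A)` and `μ′(A × B) = c_B μ_{b′,v}(A)`; testing the difference against the dilated unit boxes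
`D_n × B`, `D_n = {(x, y) : (t_n)⁻¹x ∈ 𝒪ᴺ, y ∈ 𝒪ᴺ}`, a bound `|μ̂′(D_n × B) − κ₀ μ′(D_n × B)| ≤ M ‖t_n‖^γ` with `γ < N − 1`, `‖t_n‖ → ∞`
((BOUND-b) + I-COEFF + (L-D-v), supplied by the assembly) forces `ĉ_B = κ₀ c_B` by (CV-v) (★ `eq_zero_of_integral_fibreMeasure_dilate_bound`):
**`prod_eq_smul_prod_of_dilate_bound`** — `μ̂′(A × B) = κ₀ · μ′(A × B)` for every Borel `A`.  The extension from rectangles to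
`μ̂′ = κ₀ • μ′` ((RECT), Mathlib `Measure.ext_of_generateFrom_of_iUnion`) and the sum over `b` (step (5)) are the pen's assembly.
-/

set_option autoImplicit false
-- the cell's `Summit.HodgeConjecture.HodgeConjecture.…` namespace repeats the summit name by design (D-0017 layout)
set_option linter.dupNamespace false

noncomputable section

open MeasureTheory Filter Topology Set
open scoped NNReal ENNReal Matrix Pointwise
open Literature.NumberTheory.Automorphic Literature.NumberTheory.Weil1965.SplitPlace
open Literature.NumberTheory.GaloisRepresentations.IsNonarchimedeanLocalField

namespace Summit.HodgeConjecture.HodgeConjecture.Cruxes.H413.E2SWIdentityCloseCore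

variable {K : Type*} [Field K] [ValuativeRel K] [TopologicalSpace K] [IsNonarchimedeanLocalField K]
variable {ι : Type*} [Fintype ι] [MeasurableSpace K] [BorelSpace K] (μ : Measure K) [μ.IsAddHaarMeasure]

/-- The dilated unit box `D_s = {(x, y) : s • x ∈ 𝒪^ι, y ∈ 𝒪^ι}` is a measurable subset of `K^ι × K^ι` (preimage of a closed
product of boxes under a continuous map). -/
theorem measurableSet_dilateBox (s : K) :
    MeasurableSet {z : (ι → K) × (ι → K) | (s • z.1, z.2) ∈ piPrimePowBall K ι 0 ×ˢ piPrimePowBall K ι 0} := by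
  haveI : SecondCountableTopology K := secondCountableTopology_localField K
  have hc : Continuous fun z : (ι → K) × (ι → K) => ((s • z.1, z.2) : (ι → K) × (ι → K)) :=
    (continuous_fst.const_smul s).prodMk continuous_snd
  exact ((isClosed_piPrimePowBall 0).prod (isClosed_piPrimePowBall 0)).preimage hc |>.measurableSet

/-- The real mass of the dilated unit box under the fibre measure is the integral of the dilated indicator:
`(μ_{b,v} D_s).toReal = ∫ 𝟙_{𝒪^ι×𝒪^ι}(s • x, y) dμ_{b,v}`. -/
theorem measureReal_dilateBox_eq_integral [Nonempty ι] [DecidableEq ι] [MeasurableSingletonClass K]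
    (hι : 2 ≤ Fintype.card ι) (b : K) (s : K) :
    (fibreMeasure μ hι b {z : (ι → K) × (ι → K) | (s • z.1, z.2) ∈ piPrimePowBall K ι 0 ×ˢ piPrimePowBall K ι 0}).toReal =
      ∫ z, (piPrimePowBall K ι 0 ×ˢ piPrimePowBall K ι 0).indicator (fun _ => (1 : ℝ)) (s • z.1, z.2) ∂(fibreMeasure μ hι b) := by
  rw [← measureReal_def, ← integral_indicator_one (measurableSet_dilateBox s)]
  refine integral_congr_ae (Eventually.of_forall fun z => ?_)
  show ({z : (ι → K) × (ι → K) | (s • z.1, z.2) ∈ piPrimePowBall K ι 0 ×ˢ piPrimePowBall K ι 0}).indicator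
      (1 : (ι → K) × (ι → K) → ℝ) z =
    (piPrimePowBall K ι 0 ×ˢ piPrimePowBall K ι 0).indicator (fun _ => (1 : ℝ)) (s • z.1, z.2)
  by_cases hz : (s • z.1, z.2) ∈ piPrimePowBall K ι 0 ×ˢ piPrimePowBall K ι 0
  · rw [Set.indicator_of_mem (show z ∈ {z : (ι → K) × (ι → K) |
        (s • z.1, z.2) ∈ piPrimePowBall K ι 0 ×ˢ piPrimePowBall K ι 0} from hz), Set.indicator_of_mem hz, Pi.one_apply]
  · rw [Set.indicator_of_notMem (show z ∉ {z : (ι → K) × (ι → K) |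
        (s • z.1, z.2) ∈ piPrimePowBall K ι 0 ×ˢ piPrimePowBall K ι 0} from hz), Set.indicator_of_notMem hz]

include μ in
/-- **I-CLOSE CORE AT A SPLIT PLACE (per rectangle)** [Weil1965 n° 51, (39)–(40)].  Let `|ι| ≥ 2`, `b : K`, `κ₀ : ℝ≥0`, and `μ̂`, `μ′`
measures on `(K^ι × K^ι) × Y`; fix `B ⊆ Y` such that BOTH measures have finite, `GL_ι(K)`-invariant rectangle masses on `· ×ˢ B` carried
by the split locus `S_b × B` (the hypotheses of ★ `exists_measure_prod_splitLocus_eq_mul_fibreMeasure`).  If along a sequence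
`t n ∈ K` with `‖t n‖ → ∞` the dilated-box masses satisfy `|μ̂(D_n ×ˢ B).toReal − κ₀ · μ′(D_n ×ˢ B).toReal| ≤ M ‖t n‖^γ` with `γ < |ι| − 1`,
then `μ̂(A ×ˢ B) = κ₀ · μ′(A ×ˢ B)` for every Borel `A` (both masses are multiples of `μ_{b,v}(A)`, and the difference of the two
constants is killed by ★ `eq_zero_of_integral_fibreMeasure_dilate_bound`); `μ` is any Haar measure on `K` (auxiliary: it fixes
the reference fibre measure `μ_{b,v}` used in the proof). -/
theorem prod_eq_smul_prod_of_dilate_bound [Nonempty ι] [DecidableEq ι] [MeasurableSingletonClass K]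
    (hι : 2 ≤ Fintype.card ι) (b : K) (κ₀ : ℝ≥0) {Y : Type*} [MeasurableSpace Y]
    (μhat μ' : Measure (((ι → K) × (ι → K)) × Y)) {B : Set Y}
    (hfin : ∀ C : Set ((ι → K) × (ι → K)), IsCompact C → μhat (C ×ˢ B) < ⊤)
    (hinv : ∀ (g : GL ι K) (A : Set ((ι → K) × (ι → K))), MeasurableSet A →
      μhat (((fun z => (((g : Matrix ι ι K) *ᵥ z.1, ((g⁻¹ : GL ι K) : Matrix ι ι K)ᵀ *ᵥ z.2) :
        (ι → K) × (ι → K))) ⁻¹' A) ×ˢ B) = μhat (A ×ˢ B))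
    (hcar : μhat ({z : (ι → K) × (ι → K) | z.1 ⬝ᵥ z.2 = b ∧ z.1 ≠ 0 ∧ z.2 ≠ 0}ᶜ ×ˢ B) = 0)
    (hfin' : ∀ C : Set ((ι → K) × (ι → K)), IsCompact C → μ' (C ×ˢ B) < ⊤)
    (hinv' : ∀ (g : GL ι K) (A : Set ((ι → K) × (ι → K))), MeasurableSet A →
      μ' (((fun z => (((g : Matrix ι ι K) *ᵥ z.1, ((g⁻¹ : GL ι K) : Matrix ι ι K)ᵀ *ᵥ z.2) :
        (ι → K) × (ι → K))) ⁻¹' A) ×ˢ B) = μ' (A ×ˢ B))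
    (hcar' : μ' ({z : (ι → K) × (ι → K) | z.1 ⬝ᵥ z.2 = b ∧ z.1 ≠ 0 ∧ z.2 ≠ 0}ᶜ ×ˢ B) = 0)
    {t : ℕ → K} (ht0 : ∀ n, t n ≠ 0) (ht : Tendsto (fun n => (normAbs K (t n) : ℝ)) atTop atTop)
    {M γ : ℝ} (hγ : γ < (Fintype.card ι : ℝ) - 1)
    (hbd : ∀ n, |(μhat ({z : (ι → K) × (ι → K) | ((t n)⁻¹ • z.1, z.2) ∈ piPrimePowBall K ι 0 ×ˢ piPrimePowBall K ι 0} ×ˢ B)).toReal -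
        (κ₀ : ℝ) * (μ' ({z : (ι → K) × (ι → K) | ((t n)⁻¹ • z.1, z.2) ∈ piPrimePowBall K ι 0 ×ˢ piPrimePowBall K ι 0} ×ˢ B)).toReal|
      ≤ M * (normAbs K (t n) : ℝ) ^ γ) :
    ∀ A : Set ((ι → K) × (ι → K)), MeasurableSet A → μhat (A ×ˢ B) = κ₀ * μ' (A ×ˢ B) := by
  -- (J-v) twice: the rectangle masses are multiples of the fibre measure `μ_{b,v}`
  obtain ⟨chat, hchat⟩ := exists_measure_prod_splitLocus_eq_mul_fibreMeasure μ hι b μhat hfin hinv hcar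
  obtain ⟨c', hc'⟩ := exists_measure_prod_splitLocus_eq_mul_fibreMeasure μ hι b μ' hfin' hinv' hcar'
  haveI := isFiniteMeasureOnCompacts_fibreMeasure μ hι b
  -- the dilated boxes `D_n`
  set D : ℕ → Set ((ι → K) × (ι → K)) := fun n =>
    {z : (ι → K) × (ι → K) | ((t n)⁻¹ • z.1, z.2) ∈ piPrimePowBall K ι 0 ×ˢ piPrimePowBall K ι 0} with hD
  have hDm : ∀ n, MeasurableSet (D n) := fun n => measurableSet_dilateBox (t n)⁻¹
  -- `D_n ⊆ (t n • 𝒪^ι) × 𝒪^ι` is contained in a compact product of boxes, so `μ_{b,v}(D_n) < ∞`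
  have hDfin : ∀ n, fibreMeasure μ hι b (D n) < ⊤ := by
    intro n
    obtain ⟨k, hk⟩ := exists_normAbs_eq_inv_zpow (inv_ne_zero (ht0 n))
    refine lt_of_le_of_lt (measure_mono fun z hz => ?_)
      (((isCompact_piPrimePowBall (min (-k) 0)).prod (isCompact_piPrimePowBall (min (-k) 0))).measure_lt_top
        (μ := fibreMeasure μ hι b))
    -- membership: `(t n)⁻¹ • x ∈ 𝒪^ι ⇒ x ∈ (𝔭^{-k})^ι`
    rw [Set.mem_setOf_eq, Set.mem_prod] at hz
    rw [Set.mem_prod]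
    refine ⟨piPrimePowBall_antitone (min_le_left _ _) ?_, piPrimePowBall_antitone (min_le_right _ _) hz.2⟩
    rw [mem_piPrimePowBall_iff] at hz ⊢
    intro i
    have hi : (t n)⁻¹ * z.1 i ∈ primePowBall K 0 := by simpa [Pi.smul_apply, smul_eq_mul] using hz.1 i
    have hinvn : normAbs K (t n)⁻¹⁻¹ = ((residueFieldCard K : ℝ≥0)⁻¹) ^ (-k) := by rw [map_inv₀, hk, zpow_neg]
    have h2 : (t n)⁻¹⁻¹ * ((t n)⁻¹ * z.1 i) ∈ (t n)⁻¹⁻¹ • primePowBall K 0 := Set.smul_mem_smul_set hi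
    rw [LocalFieldHaar.smul_primePowBall hinvn, inv_mul_cancel_left₀ (inv_ne_zero (ht0 n)), zero_add] at h2
    exact h2
  -- the bound in (CV-v)'s shape for `c := chat − κ₀ c'`
  have hkey : (chat : ℝ) - κ₀ * c' = 0 := by
    refine eq_zero_of_integral_fibreMeasure_dilate_bound μ hι (c := (chat : ℝ) - κ₀ * c') (M := M) hγ b ht0 ht fun n => ?_
    rw [← measureReal_dilateBox_eq_integral μ hι b (t n)⁻¹]
    have h1 : (μhat (D n ×ˢ B)).toReal = chat * (fibreMeasure μ hι b (D n)).toReal := by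
      rw [hchat (D n) (hDm n), ENNReal.toReal_mul, ENNReal.coe_toReal]
    have h2 : (μ' (D n ×ˢ B)).toReal = c' * (fibreMeasure μ hι b (D n)).toReal := by
      rw [hc' (D n) (hDm n), ENNReal.toReal_mul, ENNReal.coe_toReal]
    have h := hbd n
    rw [h1, h2, ← mul_assoc, ← sub_mul, abs_mul] at h
    convert h using 2
  -- conclude on rectangles
  have hc : chat = κ₀ * c' := by
    have h : (chat : ℝ) = κ₀ * c' := sub_eq_zero.1 hkey
    exact_mod_cast h
  intro A hA
  rw [hchat A hA, hc' A hA, hc, ENNReal.coe_mul, mul_assoc]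

end Summit.HodgeConjecture.HodgeConjecture.Cruxes.H413.E2SWIdentityCloseCore

end
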